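import Summits.QuantumFields.YangMills.Theorems.SwapVirialDeficitZeroModeSigmaFourSmallBallRateMoments
import Summits.QuantumFields.YangMills.Theorems.SwapVirialDeficitZeroModeGroupThreeLaplaceRateLayers
import HarnessLib

/-!
# Exact zero-mode rung Z5 — toward the POWER RATE of the σ-twisted four-leader small ball, measure side III-a: blocks and one-dimensional cuts in the pair frame
# (free-hands support of ⟨stmt-QuantumFields-24197⟩; split with w3 g63: deterministic Taylor package ✓`…SmallBallTaylor`, measure side w2 g56)

In the pair frame `u = ((x₀,y₀),((x_I,y_I),((x_J,y_J),(x_K,y_K))))` the majorant of the dominator is `FdomS = 𝟙_box(x₀,y₀)·innerS`,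
`innerS = 𝟙_box(q)·gS(q,w_J)·gS(q,w_K)` (✓`FdomS`).  The rate's bad regions are paid against it:
* §F `lintegral_frame_le` — Tonelli with `(x₀,y₀)` innermost: a bound `∫𝟙_box(p₀)Φ(p₀,v)dp₀ ≤ Ψ(v)` gives `∫Φ·FdomS ≤ ∫Ψ·innerS`;
* §G the block integrals: `lintegral_innerS_le` (`≤ B = hubK·I(1/3)²`), the mirror ✓`lintegral_block_weighted_le'`, and the transverse MOMENT blocks
  `lintegral_block_xmom_le` / `lintegral_block_ymom_le` (`∫((x_J²)^p + (x_K²)^p)·innerS ≤ 2·(2(4/(α²β⁴))^p)·B`, part II);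
* §H the `(x₀,y₀)`-integrals of the three kinds of cut (small axial part, Markov weight of a large transverse part, ball-flip layer via
  ✓`volume_Lset_le` with `min(2, 2√ε) ≤ 2ε^p` so that only a SMALL moment is spent); part III-b assembles the six frame cuts.
HONEST LABEL: finite-dimensional real analysis (plan-level zero-mode rung of a DRAFT line «sharp-sigma»); NOT the fixed-`L` sharp law, NOT ⟨24197⟩; the
Yang–Mills mass gap is NOT proved; no summit is proved by a line.  Width seat ym-line-sfw-p2-w2 g56 (cell ym-idea-1, free hands; own crux ⟨22884⟩ blocked-on ⟨19935⟩),
`--supports stmt-QuantumFields-24197`.  THEOREMS ONLY, standard axioms, 0 `sorry`.  References: [cite: Luscher1983, §2]; [cite: Vanbaal2001]; [folklore].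
-/

set_option autoImplicit false

noncomputable section

open MeasureTheory Quaternion Set Filter Topology
open scoped Quaternion ENNReal BigOperators
open Literature.MathematicalPhysics.QuantumLattice
open Summit.QuantumFields.YangMills.Theorems.SwapTwistDeficit.ToronLog
open Summit.QuantumFields.YangMills.Theorems.SwapVirialDeficit.ZeroModeGroup

namespace Summit.QuantumFields.YangMills.Theorems.SwapVirialDeficit.ZeroModeSigma

/-! ## §F The block constant, the inner block, Tonelli with `(x₀, y₀)` innermost -/

/-- The block constant `B(α,β) = hubK(α,β)·I(1/3)²`. [folklore] -/
def blockB (α β : ℝ) : ℝ≥0∞ := ENNReal.ofReal (hubK α β) * (Ising (1/3) * Ising (1/3))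

/-- Unfolding `blockB`. [folklore] -/
theorem blockB_def (α β : ℝ) : blockB α β = ENNReal.ofReal (hubK α β) * (Ising (1/3) * Ising (1/3)) := rfl

/-- The inner block `𝟙_box(q)·gS(q,w_J)·gS(q,w_K)` of the pair-frame majorant. [folklore] -/
def innerS (α β : ℝ) (v : (ℝ × ℝ) × ((ℝ × ℝ) × (ℝ × ℝ))) : ℝ≥0∞ :=
  sqBox.indicator (fun _ => (1 : ℝ≥0∞)) v.1 * (gS α β v.1 v.2.1 * gS α β v.1 v.2.2)

/-- Unfolding `innerS`. [folklore] -/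
theorem innerS_def (α β : ℝ) (v : (ℝ × ℝ) × ((ℝ × ℝ) × (ℝ × ℝ))) :
    innerS α β v = sqBox.indicator (fun _ => (1 : ℝ≥0∞)) v.1 * (gS α β v.1 v.2.1 * gS α β v.1 v.2.2) := rfl

/-- `innerS` is measurable. [folklore] -/
theorem measurable_innerS (α β : ℝ) : Measurable (innerS α β) := measurable_FdomS_inner α β

/-- `FdomS = 𝟙_box(x₀,y₀)·innerS`. [folklore] -/
theorem FdomS_eq (α β : ℝ) (u : (ℝ × ℝ) × ((ℝ × ℝ) × ((ℝ × ℝ) × (ℝ × ℝ)))) :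
    FdomS α β u = sqBox.indicator (fun _ => (1 : ℝ≥0∞)) u.1 * innerS α β u.2 := rfl

/-- ★ **Tonelli with `(x₀,y₀)` innermost**: if `∫ 𝟙_box(p₀)·Φ(p₀,v) dp₀ ≤ Ψ(v)` for every `v`, then `∫ Φ·FdomS ≤ ∫ Ψ·innerS`. [folklore] -/
theorem lintegral_frame_le {α β : ℝ} {Φ : (ℝ × ℝ) × ((ℝ × ℝ) × ((ℝ × ℝ) × (ℝ × ℝ))) → ℝ≥0∞} (hΦ : Measurable Φ)
    {Ψ : (ℝ × ℝ) × ((ℝ × ℝ) × (ℝ × ℝ)) → ℝ≥0∞}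
    (hb : ∀ v, ∫⁻ p₀ : ℝ × ℝ, sqBox.indicator (fun _ => (1 : ℝ≥0∞)) p₀ * Φ (p₀, v) ≤ Ψ v) :
    ∫⁻ u, Φ u * FdomS α β u ≤ ∫⁻ v, Ψ v * innerS α β v := by
  have hm : Measurable fun u : (ℝ × ℝ) × ((ℝ × ℝ) × ((ℝ × ℝ) × (ℝ × ℝ))) => Φ u * FdomS α β u := hΦ.mul (measurable_FdomS α β)
  rw [Measure.volume_eq_prod, lintegral_prod_symm _ hm.aemeasurable]
  refine lintegral_mono fun v => ?_
  have hmv : Measurable fun p₀ : ℝ × ℝ => sqBox.indicator (fun _ => (1 : ℝ≥0∞)) p₀ * Φ (p₀, v) :=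
    (measurable_const.indicator measurableSet_sqBox).mul (hΦ.comp (measurable_id.prodMk measurable_const))
  have e : ∀ p₀ : ℝ × ℝ, Φ (p₀, v) * FdomS α β (p₀, v) = sqBox.indicator (fun _ => (1 : ℝ≥0∞)) p₀ * Φ (p₀, v) * innerS α β v := by
    intro p₀; rw [FdomS_eq]; ring
  simp_rw [e]
  rw [lintegral_mul_const _ hmv]
  exact mul_le_mul' (hb v) le_rfl

/-! ## §G The block integrals -/

/-- `∫ innerS ≤ B(α,β)` (axial unit hub, `αβ ≠ 0`). [folklore] -/
theorem lintegral_innerS_le {α β : ℝ} (h1 : α ^ 2 + β ^ 2 = 1) (hα : α ≠ 0) (hβ : β ≠ 0) : ∫⁻ v, innerS α β v ≤ blockB α β := by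
  have h := lintegral_block_weighted_le h1 hα hβ (K := 1) (F := fun q w => gS α β q w) (measurable_gS α β)
    (fun q _ _ _ => by rw [one_mul])
  rw [one_mul] at h
  exact h

/-- ★ The mirror of ✓`lintegral_block_weighted_le`: the weighted factor in the `w_K` slot. [folklore] -/
theorem lintegral_block_weighted_le' {α β : ℝ} (h1 : α ^ 2 + β ^ 2 = 1) (hα : α ≠ 0) (hβ : β ≠ 0) {K : ℝ≥0∞}
    {F : (ℝ × ℝ) → (ℝ × ℝ) → ℝ≥0∞} (hFm : Measurable fun v : (ℝ × ℝ) × (ℝ × ℝ) => F v.1 v.2)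
    (hF : ∀ q : ℝ × ℝ, q.1 ^ 2 < 1 → q.2 ^ 2 < 1 → q.2 ≠ 0 → ∫⁻ w, F q w ≤ K * ∫⁻ w, gS α β q w) :
    ∫⁻ u : (ℝ × ℝ) × ((ℝ × ℝ) × (ℝ × ℝ)), sqBox.indicator (fun _ => (1 : ℝ≥0∞)) u.1 * (gS α β u.1 u.2.1 * F u.1 u.2.2) ≤
      K * (ENNReal.ofReal (hubK α β) * (Ising (1/3) * Ising (1/3))) := by
  have hσ : MeasurePreserving (Prod.map id Prod.swap : (ℝ × ℝ) × ((ℝ × ℝ) × (ℝ × ℝ)) → (ℝ × ℝ) × ((ℝ × ℝ) × (ℝ × ℝ)))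
      volume volume := by
    rw [Measure.volume_eq_prod, show (volume : Measure ((ℝ × ℝ) × (ℝ × ℝ))) = (volume : Measure (ℝ × ℝ)).prod volume from rfl]
    exact (MeasurePreserving.id (volume : Measure (ℝ × ℝ))).prod
      (Measure.measurePreserving_swap (μ := (volume : Measure (ℝ × ℝ))) (ν := (volume : Measure (ℝ × ℝ))))
  have hg : Measurable fun u : (ℝ × ℝ) × ((ℝ × ℝ) × (ℝ × ℝ)) => sqBox.indicator (fun _ => (1 : ℝ≥0∞)) u.1 * (F u.1 u.2.1 * gS α β u.1 u.2.2) := by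
    have hi : Measurable fun q : ℝ × ℝ => sqBox.indicator (fun _ => (1 : ℝ≥0∞)) q := measurable_const.indicator measurableSet_sqBox
    exact (hi.comp measurable_fst).mul ((hFm.comp (measurable_fst.prodMk (measurable_fst.comp measurable_snd))).mul
      ((measurable_gS α β).comp (measurable_fst.prodMk (measurable_snd.comp measurable_snd))))
  have hcomp := hσ.lintegral_comp hg
  calc ∫⁻ u : (ℝ × ℝ) × ((ℝ × ℝ) × (ℝ × ℝ)), sqBox.indicator (fun _ => (1 : ℝ≥0∞)) u.1 * (gS α β u.1 u.2.1 * F u.1 u.2.2)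
      = ∫⁻ u : (ℝ × ℝ) × ((ℝ × ℝ) × (ℝ × ℝ)), (fun u : (ℝ × ℝ) × ((ℝ × ℝ) × (ℝ × ℝ)) =>
          sqBox.indicator (fun _ => (1 : ℝ≥0∞)) u.1 * (F u.1 u.2.1 * gS α β u.1 u.2.2)) (Prod.map id Prod.swap u) := by
        refine lintegral_congr fun u => ?_
        simp only [Prod.map_fst, Prod.map_snd, id_eq, Prod.fst_swap, Prod.snd_swap]
        rw [mul_comm (gS α β u.1 u.2.1)]
    _ = _ := hcomp
    _ ≤ _ := lintegral_block_weighted_le h1 hα hβ hFm hF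

/-- ★ **The `x`-transverse moment block**: `∫((x_J²)^p + (x_K²)^p)·innerS ≤ 2·(2(4/(α²β⁴))^p)·B` (`0 < p ≤ 1`). [folklore] -/
theorem lintegral_block_xmom_le {α β p : ℝ} (h1 : α ^ 2 + β ^ 2 = 1) (hα : α ≠ 0) (hβ : β ≠ 0) (hp : 0 < p) (hp1 : p ≤ 1) :
    ∫⁻ v, ENNReal.ofReal ((v.2.1.1 ^ 2) ^ p + (v.2.2.1 ^ 2) ^ p) * innerS α β v ≤
      2 * (ENNReal.ofReal ((4 / (α ^ 2 * β ^ 4)) ^ p * 2) * blockB α β) := by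
  have hFm : Measurable fun v : (ℝ × ℝ) × (ℝ × ℝ) => ENNReal.ofReal ((v.2.1 ^ 2) ^ p) * gS α β v.1 v.2 :=
    (ENNReal.measurable_ofReal.comp (by fun_prop)).mul (measurable_gS α β)
  have hA := lintegral_block_weighted_le h1 hα hβ (K := ENNReal.ofReal ((4 / (α ^ 2 * β ^ 4)) ^ p * 2))
    (F := fun q w => ENNReal.ofReal ((w.1 ^ 2) ^ p) * gS α β q w) hFm (fun q hq1 hq2 hq0 => lintegral_momJ_gS_le h1 hα hβ hp hp1 hq1 hq2 hq0)
  have hB := lintegral_block_weighted_le' h1 hα hβ (K := ENNReal.ofReal ((4 / (α ^ 2 * β ^ 4)) ^ p * 2))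
    (F := fun q w => ENNReal.ofReal ((w.1 ^ 2) ^ p) * gS α β q w) hFm (fun q hq1 hq2 hq0 => lintegral_momJ_gS_le h1 hα hβ hp hp1 hq1 hq2 hq0)
  have e : ∀ v : (ℝ × ℝ) × ((ℝ × ℝ) × (ℝ × ℝ)), ENNReal.ofReal ((v.2.1.1 ^ 2) ^ p + (v.2.2.1 ^ 2) ^ p) * innerS α β v =
      sqBox.indicator (fun _ => (1 : ℝ≥0∞)) v.1 * (ENNReal.ofReal ((v.2.1.1 ^ 2) ^ p) * gS α β v.1 v.2.1 * gS α β v.1 v.2.2) +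
        sqBox.indicator (fun _ => (1 : ℝ≥0∞)) v.1 * (gS α β v.1 v.2.1 * (ENNReal.ofReal ((v.2.2.1 ^ 2) ^ p) * gS α β v.1 v.2.2)) := by
    intro v
    rw [innerS_def, ENNReal.ofReal_add (Real.rpow_nonneg (sq_nonneg _) _) (Real.rpow_nonneg (sq_nonneg _) _)]
    ring
  have hm1 : Measurable fun v : (ℝ × ℝ) × ((ℝ × ℝ) × (ℝ × ℝ)) =>
      sqBox.indicator (fun _ => (1 : ℝ≥0∞)) v.1 * (ENNReal.ofReal ((v.2.1.1 ^ 2) ^ p) * gS α β v.1 v.2.1 * gS α β v.1 v.2.2) := by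
    have hi : Measurable fun q : ℝ × ℝ => sqBox.indicator (fun _ => (1 : ℝ≥0∞)) q := measurable_const.indicator measurableSet_sqBox
    exact (hi.comp measurable_fst).mul ((hFm.comp (measurable_fst.prodMk (measurable_fst.comp measurable_snd))).mul
      ((measurable_gS α β).comp (measurable_fst.prodMk (measurable_snd.comp measurable_snd))))
  simp_rw [e]
  rw [lintegral_add_left hm1, two_mul]
  exact add_le_add hA hB

/-- ★ **The `y`-transverse moment block**: `∫((y_J²)^p + (y_K²)^p)·innerS ≤ 2·(2(4/(α²β⁴))^p)·B` (`0 < p ≤ 1`). [folklore] -/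
theorem lintegral_block_ymom_le {α β p : ℝ} (h1 : α ^ 2 + β ^ 2 = 1) (hα : α ≠ 0) (hβ : β ≠ 0) (hp : 0 < p) (hp1 : p ≤ 1) :
    ∫⁻ v, ENNReal.ofReal ((v.2.1.2 ^ 2) ^ p + (v.2.2.2 ^ 2) ^ p) * innerS α β v ≤
      2 * (ENNReal.ofReal ((4 / (α ^ 2 * β ^ 4)) ^ p * 2) * blockB α β) := by
  have hFm : Measurable fun v : (ℝ × ℝ) × (ℝ × ℝ) => ENNReal.ofReal ((v.2.2 ^ 2) ^ p) * gS α β v.1 v.2 :=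
    (ENNReal.measurable_ofReal.comp (by fun_prop)).mul (measurable_gS α β)
  have hA := lintegral_block_weighted_le h1 hα hβ (K := ENNReal.ofReal ((4 / (α ^ 2 * β ^ 4)) ^ p * 2))
    (F := fun q w => ENNReal.ofReal ((w.2 ^ 2) ^ p) * gS α β q w) hFm (fun q hq1 hq2 hq0 => lintegral_momK_gS_le h1 hα hβ hp hp1 hq1 hq2 hq0)
  have hB := lintegral_block_weighted_le' h1 hα hβ (K := ENNReal.ofReal ((4 / (α ^ 2 * β ^ 4)) ^ p * 2))
    (F := fun q w => ENNReal.ofReal ((w.2 ^ 2) ^ p) * gS α β q w) hFm (fun q hq1 hq2 hq0 => lintegral_momK_gS_le h1 hα hβ hp hp1 hq1 hq2 hq0)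
  have e : ∀ v : (ℝ × ℝ) × ((ℝ × ℝ) × (ℝ × ℝ)), ENNReal.ofReal ((v.2.1.2 ^ 2) ^ p + (v.2.2.2 ^ 2) ^ p) * innerS α β v =
      sqBox.indicator (fun _ => (1 : ℝ≥0∞)) v.1 * (ENNReal.ofReal ((v.2.1.2 ^ 2) ^ p) * gS α β v.1 v.2.1 * gS α β v.1 v.2.2) +
        sqBox.indicator (fun _ => (1 : ℝ≥0∞)) v.1 * (gS α β v.1 v.2.1 * (ENNReal.ofReal ((v.2.2.2 ^ 2) ^ p) * gS α β v.1 v.2.2)) := by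
    intro v
    rw [innerS_def, ENNReal.ofReal_add (Real.rpow_nonneg (sq_nonneg _) _) (Real.rpow_nonneg (sq_nonneg _) _)]
    ring
  have hm1 : Measurable fun v : (ℝ × ℝ) × ((ℝ × ℝ) × (ℝ × ℝ)) =>
      sqBox.indicator (fun _ => (1 : ℝ≥0∞)) v.1 * (ENNReal.ofReal ((v.2.1.2 ^ 2) ^ p) * gS α β v.1 v.2.1 * gS α β v.1 v.2.2) := by
    have hi : Measurable fun q : ℝ × ℝ => sqBox.indicator (fun _ => (1 : ℝ≥0∞)) q := measurable_const.indicator measurableSet_sqBox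
    exact (hi.comp measurable_fst).mul ((hFm.comp (measurable_fst.prodMk (measurable_fst.comp measurable_snd))).mul
      ((measurable_gS α β).comp (measurable_fst.prodMk (measurable_snd.comp measurable_snd))))
  simp_rw [e]
  rw [lintegral_add_left hm1, two_mul]
  exact add_le_add hA hB

/-! ## §H The `(x₀,y₀)`-integrals of the three kinds of cut -/

/-- `vol{u | u² < c} = 2√c` (`c ≥ 0`). [folklore] -/
theorem volume_sq_lt (c : ℝ) : (volume : Measure ℝ) {u : ℝ | u ^ 2 < c} = ENNReal.ofReal (2 * Real.sqrt c) := by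
  have e : {u : ℝ | u ^ 2 < c} = Set.Ioo (-Real.sqrt c) (Real.sqrt c) := by
    ext u; rw [Set.mem_setOf_eq, Set.mem_Ioo, Real.sq_lt]
  rw [e, Real.volume_Ioo]; congr 1; ring

/-- The `(x₀,y₀)`-integral of a cut on `x₀` alone: `∫ 𝟙_box(p₀)·𝟙{x₀² + a < c} ≤ 2√c·2` (`a ≥ 0`, `c ≥ 0`). [folklore] -/
theorem lintegral_sqBox_fst_cut_le {a : ℝ} (ha : 0 ≤ a) (c : ℝ) :
    ∫⁻ p₀ : ℝ × ℝ, sqBox.indicator (fun _ => (1 : ℝ≥0∞)) p₀ * {p₀ : ℝ × ℝ | p₀.1 ^ 2 + a < c}.indicator (fun _ => (1 : ℝ≥0∞)) p₀ ≤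
      ENNReal.ofReal (2 * Real.sqrt c) * 2 := by
  have hPm : MeasurableSet ({u : ℝ | u ^ 2 < c} ×ˢ {u : ℝ | u ^ 2 < 1}) :=
    (measurableSet_lt (measurable_id.pow_const 2) measurable_const).prod measurableSet_sqLine
  calc ∫⁻ p₀ : ℝ × ℝ, sqBox.indicator (fun _ => (1 : ℝ≥0∞)) p₀ * {p₀ : ℝ × ℝ | p₀.1 ^ 2 + a < c}.indicator (fun _ => (1 : ℝ≥0∞)) p₀
      ≤ ∫⁻ p₀ : ℝ × ℝ, ({u : ℝ | u ^ 2 < c} ×ˢ {u : ℝ | u ^ 2 < 1}).indicator (1 : ℝ × ℝ → ℝ≥0∞) p₀ := by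
        refine lintegral_mono fun p₀ => ?_
        by_cases h1 : p₀ ∈ sqBox
        · by_cases h2 : p₀ ∈ {p₀ : ℝ × ℝ | p₀.1 ^ 2 + a < c}
          · have h2' : p₀.1 ^ 2 + a < c := h2
            have hP : p₀ ∈ {u : ℝ | u ^ 2 < c} ×ˢ {u : ℝ | u ^ 2 < 1} := ⟨by show p₀.1 ^ 2 < c; linarith, h1.2⟩
            rw [indicator_of_mem h1, indicator_of_mem h2, indicator_of_mem hP, one_mul, Pi.one_apply]
          · rw [indicator_of_notMem h2, mul_zero]; exact bot_le
        · rw [indicator_of_notMem h1, zero_mul]; exact bot_le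
    _ = ENNReal.ofReal (2 * Real.sqrt c) * 2 := by
        rw [lintegral_indicator_one hPm, Measure.volume_eq_prod, Measure.prod_prod, volume_sq_lt c, volume_sqBox_one]

/-- The same for a cut on `y₀` alone: `∫ 𝟙_box(p₀)·𝟙{y₀² + a < c} ≤ 2·2√c`. [folklore] -/
theorem lintegral_sqBox_snd_cut_le {a : ℝ} (ha : 0 ≤ a) (c : ℝ) :
    ∫⁻ p₀ : ℝ × ℝ, sqBox.indicator (fun _ => (1 : ℝ≥0∞)) p₀ * {p₀ : ℝ × ℝ | p₀.2 ^ 2 + a < c}.indicator (fun _ => (1 : ℝ≥0∞)) p₀ ≤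
      2 * ENNReal.ofReal (2 * Real.sqrt c) := by
  have hPm : MeasurableSet ({u : ℝ | u ^ 2 < 1} ×ˢ {u : ℝ | u ^ 2 < c}) :=
    measurableSet_sqLine.prod (measurableSet_lt (measurable_id.pow_const 2) measurable_const)
  calc ∫⁻ p₀ : ℝ × ℝ, sqBox.indicator (fun _ => (1 : ℝ≥0∞)) p₀ * {p₀ : ℝ × ℝ | p₀.2 ^ 2 + a < c}.indicator (fun _ => (1 : ℝ≥0∞)) p₀
      ≤ ∫⁻ p₀ : ℝ × ℝ, ({u : ℝ | u ^ 2 < 1} ×ˢ {u : ℝ | u ^ 2 < c}).indicator (1 : ℝ × ℝ → ℝ≥0∞) p₀ := by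
        refine lintegral_mono fun p₀ => ?_
        by_cases h1 : p₀ ∈ sqBox
        · by_cases h2 : p₀ ∈ {p₀ : ℝ × ℝ | p₀.2 ^ 2 + a < c}
          · have h2' : p₀.2 ^ 2 + a < c := h2
            have hP : p₀ ∈ {u : ℝ | u ^ 2 < 1} ×ˢ {u : ℝ | u ^ 2 < c} := ⟨h1.1, by show p₀.2 ^ 2 < c; linarith⟩
            rw [indicator_of_mem h1, indicator_of_mem h2, indicator_of_mem hP, one_mul, Pi.one_apply]
          · rw [indicator_of_notMem h2, mul_zero]; exact bot_le
        · rw [indicator_of_notMem h1, zero_mul]; exact bot_le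
    _ = 2 * ENNReal.ofReal (2 * Real.sqrt c) := by
        rw [lintegral_indicator_one hPm, Measure.volume_eq_prod, Measure.prod_prod, volume_sq_lt c, volume_sqBox_one]

/-- Markov's step with a power: `T < X`, `T > 0`, `0 ≤ p` ⇒ `1 ≤ T^{−p}·X^p`. [folklore] -/
theorem one_le_rpow_markov {T X p : ℝ} (hT : 0 < T) (hp : 0 ≤ p) (h : T < X) : (1:ℝ) ≤ T ^ (-p) * X ^ p := by
  have hX : 0 < X := hT.trans h
  rw [Real.rpow_neg hT.le, ← Real.inv_rpow hT.le, ← Real.mul_rpow (inv_nonneg.2 hT.le) hX.le]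
  refine Real.one_le_rpow ?_ hp
  rw [inv_mul_eq_div, le_div_iff₀ hT, one_mul]; exact h.le

/-- The Markov weight of the transverse cut: `𝟙{T < X_J + X_K} ≤ T^{−p}((X_J)^p + (X_K)^p)` (`X_• = x_•² ≥ 0`, `0 ≤ p ≤ 1`). [folklore] -/
theorem indicator_large_le {T p a b : ℝ} (hT : 0 < T) (hp : 0 ≤ p) (hp1 : p ≤ 1) (ha : 0 ≤ a) (hb : 0 ≤ b) :
    {c : ℝ | T < c}.indicator (fun _ => (1 : ℝ≥0∞)) (a + b) ≤ ENNReal.ofReal (T ^ (-p) * (a ^ p + b ^ p)) := by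
  by_cases h : a + b ∈ {c : ℝ | T < c}
  · rw [indicator_of_mem h, ← ENNReal.ofReal_one]
    refine ENNReal.ofReal_le_ofReal ((one_le_rpow_markov hT hp h).trans ?_)
    exact mul_le_mul_of_nonneg_left (Real.rpow_add_le_add_rpow ha hb hp hp1) (Real.rpow_nonneg hT.le _)
  · rw [indicator_of_notMem h]; exact bot_le

/-- The `(x₀,y₀)`-integral of the ball-flip layer: `∫ 𝟙_box(p₀)·𝟙{1 − e ≤ x₀² + a < 1} ≤ 2e^p·2` (`a, e ≥ 0`, `0 < p ≤ 1/2`). [folklore] -/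
theorem lintegral_sqBox_fst_layer_le {a e p : ℝ} (ha : 0 ≤ a) (he : 0 ≤ e) (hp : 0 < p) (hp2 : p ≤ 1 / 2) :
    ∫⁻ p₀ : ℝ × ℝ, sqBox.indicator (fun _ => (1 : ℝ≥0∞)) p₀ *
      {p₀ : ℝ × ℝ | 1 - e ≤ p₀.1 ^ 2 + a ∧ p₀.1 ^ 2 + a < 1}.indicator (fun _ => (1 : ℝ≥0∞)) p₀ ≤ ENNReal.ofReal (2 * e ^ p) * 2 := by
  have hPm : MeasurableSet (Lset a e ×ˢ {u : ℝ | u ^ 2 < 1}) := (measurableSet_Lset a e).prod measurableSet_sqLine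
  calc ∫⁻ p₀ : ℝ × ℝ, sqBox.indicator (fun _ => (1 : ℝ≥0∞)) p₀ *
        {p₀ : ℝ × ℝ | 1 - e ≤ p₀.1 ^ 2 + a ∧ p₀.1 ^ 2 + a < 1}.indicator (fun _ => (1 : ℝ≥0∞)) p₀
      ≤ ∫⁻ p₀ : ℝ × ℝ, (Lset a e ×ˢ {u : ℝ | u ^ 2 < 1}).indicator (1 : ℝ × ℝ → ℝ≥0∞) p₀ := by
        refine lintegral_mono fun p₀ => ?_
        by_cases h1 : p₀ ∈ sqBox
        · by_cases h2 : p₀ ∈ {p₀ : ℝ × ℝ | 1 - e ≤ p₀.1 ^ 2 + a ∧ p₀.1 ^ 2 + a < 1}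
          · have h2' : 1 - e ≤ p₀.1 ^ 2 + a ∧ p₀.1 ^ 2 + a < 1 := h2
            have hP : p₀ ∈ Lset a e ×ˢ {u : ℝ | u ^ 2 < 1} := ⟨(mem_Lset a e p₀.1).2 ⟨h2'.2, by linarith [h2'.1]⟩, h1.2⟩
            rw [indicator_of_mem h1, indicator_of_mem h2, indicator_of_mem hP, one_mul, Pi.one_apply]
          · rw [indicator_of_notMem h2, mul_zero]; exact bot_le
        · rw [indicator_of_notMem h1, zero_mul]; exact bot_le
    _ ≤ ENNReal.ofReal (2 * e ^ p) * 2 := by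
        rw [lintegral_indicator_one hPm, Measure.volume_eq_prod, Measure.prod_prod, volume_sqBox_one]
        exact mul_le_mul' (volume_Lset_le ha he hp hp2) le_rfl

/-- The same for the `y₀`-layer. [folklore] -/
theorem lintegral_sqBox_snd_layer_le {a e p : ℝ} (ha : 0 ≤ a) (he : 0 ≤ e) (hp : 0 < p) (hp2 : p ≤ 1 / 2) :
    ∫⁻ p₀ : ℝ × ℝ, sqBox.indicator (fun _ => (1 : ℝ≥0∞)) p₀ *
      {p₀ : ℝ × ℝ | 1 - e ≤ p₀.2 ^ 2 + a ∧ p₀.2 ^ 2 + a < 1}.indicator (fun _ => (1 : ℝ≥0∞)) p₀ ≤ 2 * ENNReal.ofReal (2 * e ^ p) := by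
  have hPm : MeasurableSet ({u : ℝ | u ^ 2 < 1} ×ˢ Lset a e) := measurableSet_sqLine.prod (measurableSet_Lset a e)
  calc ∫⁻ p₀ : ℝ × ℝ, sqBox.indicator (fun _ => (1 : ℝ≥0∞)) p₀ *
        {p₀ : ℝ × ℝ | 1 - e ≤ p₀.2 ^ 2 + a ∧ p₀.2 ^ 2 + a < 1}.indicator (fun _ => (1 : ℝ≥0∞)) p₀
      ≤ ∫⁻ p₀ : ℝ × ℝ, ({u : ℝ | u ^ 2 < 1} ×ˢ Lset a e).indicator (1 : ℝ × ℝ → ℝ≥0∞) p₀ := by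
        refine lintegral_mono fun p₀ => ?_
        by_cases h1 : p₀ ∈ sqBox
        · by_cases h2 : p₀ ∈ {p₀ : ℝ × ℝ | 1 - e ≤ p₀.2 ^ 2 + a ∧ p₀.2 ^ 2 + a < 1}
          · have h2' : 1 - e ≤ p₀.2 ^ 2 + a ∧ p₀.2 ^ 2 + a < 1 := h2
            have hP : p₀ ∈ {u : ℝ | u ^ 2 < 1} ×ˢ Lset a e := ⟨h1.1, (mem_Lset a e p₀.2).2 ⟨h2'.2, by linarith [h2'.1]⟩⟩
            rw [indicator_of_mem h1, indicator_of_mem h2, indicator_of_mem hP, one_mul, Pi.one_apply]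
          · rw [indicator_of_notMem h2, mul_zero]; exact bot_le
        · rw [indicator_of_notMem h1, zero_mul]; exact bot_le
    _ ≤ 2 * ENNReal.ofReal (2 * e ^ p) := by
        rw [lintegral_indicator_one hPm, Measure.volume_eq_prod, Measure.prod_prod, volume_sqBox_one]
        exact mul_le_mul' le_rfl (volume_Lset_le ha he hp hp2)

/-- `(s²(a + b))^p ≤ s^{2p}(a^p + b^p)` for `a, b ≥ 0`, `0 ≤ p ≤ 1`. [folklore] -/
theorem rpow_layer_weight_le {s a b p : ℝ} (ha : 0 ≤ a) (hb : 0 ≤ b) (hp : 0 ≤ p) (hp1 : p ≤ 1) :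
    (s ^ 2 * (a + b)) ^ p ≤ (s ^ 2) ^ p * (a ^ p + b ^ p) := by
  rw [Real.mul_rpow (sq_nonneg s) (add_nonneg ha hb)]
  exact mul_le_mul_of_nonneg_left (Real.rpow_add_le_add_rpow ha hb hp hp1) (Real.rpow_nonneg (sq_nonneg s) _)

end Summit.QuantumFields.YangMills.Theorems.SwapVirialDeficit.ZeroModeSigma

end
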